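import Summits.QuantumFields.YangMills.Theorems.SwapVirialDeficitSwapMeanActionApriori
import Summits.QuantumFields.YangMills.Theorems.SwapVirialDeficitZeroModeGroupThreeLaplaceRateWeights
import HarnessLib

/-!
# WINDOW-UNIFORM CONCENTRATION of the σ-glued principal deficit: all Gibbs moments `⟨F₀^p⟩_b` at scale `L⁴·log b ∕ b`

The virial window row of ⟨stmt-QuantumFields-24197⟩ `SwapVirialDeficit.SwapGluedStiffness` (✓`virial_ring`, D2 ✓`swapGluedStiffness_of_virialWindow`)
carries the remainder `β·K_L⟪R⟫`, `R = F̂ − ½XF̂` third order along the Euler field.  Its followers' part is pointwise `O(poly(L)·F̂^{3/2})` on the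
Taylor region, so it is negligible on a window as soon as `β·⟨F̂^{3/2}⟩_β = o(1)` UNIFORMLY IN `L` — a CONCENTRATION input for the deficit under
the interacting Gibbs law that Jensen does not give (`x ↦ x^{3/2}` is convex; fcl-p3 g46 2026-08-31 15:00Z caveat, memo2 §3).  This file supplies it,
for ALL moments at once, from convexity of `b ↦ log Z(b)` alone:

* §1 (generic probability space, bounded measurable `F ≥ 0`): ★ `integral_exp_neg_sub_mul_le` — TILT: `Z(b − t) ≤ exp(t·⟨F⟩_{b−t})·Z(b)`
  (`log Z` convex, Mathlib `ConvexOn.slope_le_deriv` on ✓`convexOn_log_integral_exp_mul` ∕ ✓`hasDerivAt_log_integral_exp_mul_of_ae_bound`);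
  ★ `integral_rpow_mul_exp_neg_le_tilt` — `∫ F^p e^{−bF} ≤ (p/t)^p·Z(b − t)` (pointwise `F^p e^{−tF} ≤ (p/t)^p`, ✓`ZeroModeGroup.rpow_mul_exp_neg_le`);
  ★★ `integral_rpow_mul_exp_neg_le_of_apriori` — under an a-priori ceiling `s·⟨F⟩_s ≤ A·log s + B` (`s ≥ β₀`), for `b ≥ 2β₀` and EVERY `p > 0`:
  `∫ F^p e^{−bF} ≤ e·(2p(A log b + B + 1)/b)^p·Z(b)` (tilt by `t = b/(2(A log b + B + 1))`, so that `t⟨F⟩_{b−t} ≤ 1`);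
* §2 the σ-glued ring, principal sector `F₀ = swapRingDeficit L 0`, `μ_L = ringMeasure L`, `Z₀(b) = ∫ e^{−bF₀} dμ_L`, with the absolute constants of
  ✓`swap_meanDeficit_apriori`: ★★★ `swap_deficit_rpow_moment_le` — ABSOLUTE `C > 0`, `β₁ ≥ 1` with, for EVERY `L ≥ 1`, `b ≥ β₁`, `p > 0`,
  `∫ F₀^p e^{−bF₀} dμ_L ≤ e·(C·p·L⁴·(1 + log L + log b)/b)^p·Z₀(b)` — the Gibbs law of `F₀` is concentrated at scale `L⁴ log b ∕ b` with
  super-polynomial tails, no window condition; ★★ `swap_deficit_sq_moment_le` (`p = 2`), ★★ `swap_deficit_threeHalves_moment_le`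
  (`b·∫F₀^{3/2}e^{−bF₀} ≤ e·(3C/2·L⁴·ℓ)^{3/2}·b^{−1/2}·Z₀`, `ℓ = 1 + log L + log b`: the followers' cubic remainder is FREE on any window `L ≤ b^a`,
  `a < 1/12`), ★ `swap_deficit_gibbs_tail_le` (Chebyshev: `∫ 𝟙{s ≤ F₀} e^{−bF₀} ≤ e·(CpL⁴ℓ/(bs))^p·Z₀`, every `p`), and the ε-window form
  ★★ `swap_deficit_threeHalves_window` (`∀ q ≥ 0, ε > 0 ∃ a > 0, β₂: b ≥ β₂, L ≤ b^a ⟹ b·L^q·∫F₀^{3/2}e^{−bF₀} ≤ ε·Z₀`).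

HONEST LABEL: crude window-uniform bookkeeping (concentration at the a-priori scale, which is `2 log b` times the true scale `9L⁴/b`) for the DRAFT
virial line; the valley term (LW) ∕ the minus sector (M) ∕ ⟨24197⟩ (window-uniform) ∕ ⟨24194⟩ ∕ ⟨24196⟩ ∕ ⟨24497⟩ stay OPEN; own crux ⟨22884⟩ OPEN
(blocked-on ⟨19935⟩); no crux, rung of record or summit is proved; the Yang–Mills mass gap is NOT proved; no summit is proved by a line.
THEOREMS ONLY (0 `def`, 0 `sorry`), standard axioms.  Width seat ym-line-sfw-p2-w3 g65 (cell ym-idea-1, free hands), `--supports stmt-QuantumFields-24197`.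
References: [cite: Griffiths1964] (convexity of `log Z`); [cite: tHooft1979]; [cite: Luscher1983, §2]; [folklore] (Chernoff ∕ Chebyshev).
-/

set_option autoImplicit false

noncomputable section

open MeasureTheory Set Filter
open scoped BigOperators Topology
open Literature.MathematicalPhysics.QuantumFieldTheory hiding SU2
open Literature.MathematicalPhysics.QuantumLattice

namespace Summit.QuantumFields.YangMills.Theorems.SwapVirialDeficit.SwapRing

open Summit.QuantumFields.YangMills.Theorems.FemtoTransferGap
open Summit.QuantumFields.YangMills.Theorems.VirialFluxGap.RingDeficit
open Summit.QuantumFields.YangMills.Theorems.PortZD (hasDerivAt_log_integral_exp_mul_of_ae_bound integrable_exp_mul_of_ae_bound)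
open Summit.QuantumFields.YangMills.Theorems.SwapVirialDeficit.ZeroModeGroup (rpow_mul_exp_neg_le)

/-! ## §1 Generic: tilting a Laplace transform by convexity; moments against a tilt; moments under an a-priori ceiling -/

section Generic

variable {X : Type*} [MeasurableSpace X] (μ : Measure X) [IsProbabilityMeasure μ] {F : X → ℝ} {M : ℝ}

/-- ★ **TILT BY CONVEXITY**: for bounded measurable `F` on a probability space, `b ∈ ℝ` and `t > 0`,
`Z(b − t) ≤ exp(t·⟨F⟩_{b−t})·Z(b)`, where `Z(s) = ∫ e^{−sF} dμ` and `⟨F⟩_s = ∫ F e^{−sF} ∕ Z(s)` — the supporting line of the convex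
function `s ↦ log Z(s)` at `b − t`. [cite: Griffiths1964] -/
theorem integral_exp_neg_sub_mul_le (hF : Measurable F) (hbd : ∀ x, |F x| ≤ M) (b : ℝ) {t : ℝ} (ht : 0 < t) :
    ∫ x, Real.exp (-(b - t) * F x) ∂μ ≤
      Real.exp (t * ((∫ x, F x * Real.exp (-(b - t) * F x) ∂μ) / ∫ x, Real.exp (-(b - t) * F x) ∂μ)) *
        ∫ x, Real.exp (-b * F x) ∂μ := by
  have hgc := convexOn_log_integral_exp_mul μ hF hbd
  have hd := hasDerivAt_log_integral_exp_mul_of_ae_bound (μ := μ) hF.aestronglyMeasurable (ae_of_all _ hbd) (-(b - t))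
  have h := hgc.slope_le_deriv (mem_univ (-b)) (mem_univ (-(b - t))) (by linarith : -b < -(b - t)) hd.differentiableAt
  rw [hd.deriv, slope_def_field, show -(b - t) - -b = t by ring, div_le_iff₀ ht] at h
  have hZb : 0 < ∫ x, Real.exp (-b * F x) ∂μ :=
    integral_exp_pos (integrable_exp_mul_of_ae_bound hF.aestronglyMeasurable (ae_of_all _ hbd) (-b))
  have hZbt : 0 < ∫ x, Real.exp (-(b - t) * F x) ∂μ :=
    integral_exp_pos (integrable_exp_mul_of_ae_bound hF.aestronglyMeasurable (ae_of_all _ hbd) (-(b - t)))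
  calc ∫ x, Real.exp (-(b - t) * F x) ∂μ = Real.exp (Real.log (∫ x, Real.exp (-(b - t) * F x) ∂μ)) := (Real.exp_log hZbt).symm
    _ ≤ Real.exp (t * ((∫ x, F x * Real.exp (-(b - t) * F x) ∂μ) / ∫ x, Real.exp (-(b - t) * F x) ∂μ) +
          Real.log (∫ x, Real.exp (-b * F x) ∂μ)) := Real.exp_le_exp.2 (by linarith)
    _ = _ := by rw [Real.exp_add, Real.exp_log hZb]

/-- ★ **MOMENTS AGAINST A TILT**: for bounded measurable `F ≥ 0`, `t > 0`, `p > 0` and any `b`,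
`∫ F^p e^{−bF} dμ ≤ (p/t)^p · ∫ e^{−(b−t)F} dμ` (pointwise `F^p e^{−tF} ≤ (p/t)^p`, ✓`ZeroModeGroup.rpow_mul_exp_neg_le`). [folklore] -/
theorem integral_rpow_mul_exp_neg_le_tilt (hF : Measurable F) (hbd : ∀ x, |F x| ≤ M) (h0 : ∀ x, 0 ≤ F x) (b : ℝ) {t p : ℝ}
    (ht : 0 < t) (hp : 0 < p) :
    ∫ x, F x ^ p * Real.exp (-b * F x) ∂μ ≤ (p / t) ^ p * ∫ x, Real.exp (-(b - t) * F x) ∂μ := by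
  rw [← integral_const_mul]
  refine integral_mono_of_nonneg (ae_of_all _ fun x => mul_nonneg (Real.rpow_nonneg (h0 x) _) (Real.exp_pos _).le)
    ((integrable_exp_mul_of_ae_bound hF.aestronglyMeasurable (ae_of_all _ hbd) (-(b - t))).const_mul _) (ae_of_all _ fun x => ?_)
  show F x ^ p * Real.exp (-b * F x) ≤ (p / t) ^ p * Real.exp (-(b - t) * F x)
  have h1 := rpow_mul_exp_neg_le (h0 x) ht hp
  have e1 : F x ^ p * Real.exp (-b * F x) = (F x ^ p * Real.exp (-(t * F x))) * Real.exp (-(b - t) * F x) := by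
    rw [mul_assoc, ← Real.exp_add]; congr 2; ring
  rw [e1]
  exact mul_le_mul_of_nonneg_right h1 (Real.exp_pos _).le

/-- ★★ **ALL MOMENTS UNDER AN A-PRIORI CEILING**: let `F ≥ 0` be bounded measurable on a probability space and suppose the Gibbs means obey
`s·⟨F⟩_s ≤ A·log s + B` for `s ≥ β₀` (`A, B ≥ 0`, `β₀ ≥ 1`).  Then for every `b ≥ 2β₀` and every `p > 0`,
`∫ F^p e^{−bF} dμ ≤ e · (2p·(A·log b + B + 1)/b)^p · ∫ e^{−bF} dμ`,
i.e. `⟨F^p⟩_b ≤ e·(2p(A log b + B + 1)/b)^p`: the Gibbs law of `F` concentrates at the a-priori scale `(A log b + B)/b` with super-polynomial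
tails (tilt by `t = b/(2(A log b + B + 1))`, for which `t·⟨F⟩_{b−t} ≤ 1`). [cite: Griffiths1964] [folklore] -/
theorem integral_rpow_mul_exp_neg_le_of_apriori (hF : Measurable F) (hbd : ∀ x, |F x| ≤ M) (h0 : ∀ x, 0 ≤ F x) {A B β₀ : ℝ}
    (hA : 0 ≤ A) (hB : 0 ≤ B) (hβ₀ : 1 ≤ β₀)
    (hap : ∀ s : ℝ, β₀ ≤ s → s * ((∫ x, F x * Real.exp (-s * F x) ∂μ) / ∫ x, Real.exp (-s * F x) ∂μ) ≤ A * Real.log s + B)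
    {b : ℝ} (hb : 2 * β₀ ≤ b) {p : ℝ} (hp : 0 < p) :
    ∫ x, F x ^ p * Real.exp (-b * F x) ∂μ ≤
      Real.exp 1 * (2 * p * (A * Real.log b + B + 1) / b) ^ p * ∫ x, Real.exp (-b * F x) ∂μ := by
  have hb1 : 1 ≤ b := by linarith
  have hb0 : 0 < b := by linarith
  have hlogb : 0 ≤ Real.log b := Real.log_nonneg hb1
  set D : ℝ := A * Real.log b + B + 1 with hD
  have hD1 : 1 ≤ D := by rw [hD]; nlinarith
  have hD0 : 0 < D := by linarith
  set t : ℝ := b / (2 * D) with htdef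
  have ht0 : 0 < t := by rw [htdef]; positivity
  have htb : t ≤ b / 2 := by
    rw [htdef, div_le_div_iff₀ (by positivity) (by norm_num)]
    nlinarith
  set s : ℝ := b - t with hsdef
  have hsβ : β₀ ≤ s := by rw [hsdef]; linarith
  have hs0 : 0 < s := by linarith
  have hsb : s ≤ b := by rw [hsdef]; linarith
  -- the Gibbs mean at `s = b − t` and the a-priori ceiling there
  set m : ℝ := (∫ x, F x * Real.exp (-s * F x) ∂μ) / ∫ x, Real.exp (-s * F x) ∂μ with hmdef
  have hZs : 0 < ∫ x, Real.exp (-s * F x) ∂μ :=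
    integral_exp_pos (integrable_exp_mul_of_ae_bound hF.aestronglyMeasurable (ae_of_all _ hbd) (-s))
  have hm0 : 0 ≤ m := by
    rw [hmdef]
    exact div_nonneg (integral_nonneg fun x => mul_nonneg (h0 x) (Real.exp_pos _).le) hZs.le
  have hsm : s * m ≤ D - 1 := by
    have h1 := hap s hsβ
    have h2 : A * Real.log s ≤ A * Real.log b := mul_le_mul_of_nonneg_left (Real.log_le_log hs0 hsb) hA
    rw [hD]; linarith
  have htm : t * m ≤ 1 := by
    -- `t ≤ s / D` (as `s ≥ b/2` and `t = b/(2D)`), so `t·m ≤ (s·m)/D ≤ (D − 1)/D ≤ 1`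
    have hts : t * D ≤ s := by
      have e : t * D = b / 2 := by rw [htdef]; field_simp
      rw [e]; linarith
    have : t * m * D ≤ D - 1 := by nlinarith
    nlinarith
  -- assemble
  have h1 := integral_rpow_mul_exp_neg_le_tilt μ hF hbd h0 b ht0 hp
  have h2 := integral_exp_neg_sub_mul_le μ hF hbd b ht0
  have hZb : 0 ≤ ∫ x, Real.exp (-b * F x) ∂μ := integral_nonneg fun x => (Real.exp_pos _).le
  have hexp : Real.exp (t * m) ≤ Real.exp 1 := Real.exp_le_exp.2 htm
  have hpt : (p / t) ^ p = (2 * p * D / b) ^ p := by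
    congr 1; rw [htdef]; field_simp
  calc ∫ x, F x ^ p * Real.exp (-b * F x) ∂μ ≤ (p / t) ^ p * ∫ x, Real.exp (-(b - t) * F x) ∂μ := h1
    _ ≤ (p / t) ^ p * (Real.exp (t * m) * ∫ x, Real.exp (-b * F x) ∂μ) := mul_le_mul_of_nonneg_left h2 (by positivity)
    _ ≤ (p / t) ^ p * (Real.exp 1 * ∫ x, Real.exp (-b * F x) ∂μ) :=
        mul_le_mul_of_nonneg_left (mul_le_mul_of_nonneg_right hexp hZb) (by positivity)
    _ = Real.exp 1 * (2 * p * D / b) ^ p * ∫ x, Real.exp (-b * F x) ∂μ := by rw [hpt]; ring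

end Generic

/-! ## §2 The σ-glued ring: window-uniform moments of the principal-sector deficit -/

/-- ★★★ **WINDOW-UNIFORM ALL-MOMENT BOUND FOR THE σ-GLUED PRINCIPAL DEFICIT**: there are ABSOLUTE `C > 0`, `β₁ ≥ 1` such that for EVERY `L ≥ 1`,
every `b ≥ β₁` and every real `p > 0`,
`∫ F₀^p e^{−bF₀} dμ_L ≤ e · (C·p·L⁴·(1 + log L + log b)/b)^p · ∫ e^{−bF₀} dμ_L`,
`F₀ = swapRingDeficit L 0`, `μ_L = ringMeasure L`; i.e. `⟨F₀^p⟩_b^{1/p} ≤ e^{1/p}·C·p·L⁴(1 + log L + log b)/b`: the Gibbs law of the deficit is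
concentrated at scale `L⁴ log b ∕ b` with super-polynomial tails, uniformly in `L`, no window condition (✓`swap_meanDeficit_apriori` fed into
`integral_rpow_mul_exp_neg_le_of_apriori`). [cite: Griffiths1964] [cite: tHooft1979] [cite: Luscher1983, §2] -/
theorem swap_deficit_rpow_moment_le :
    ∃ C : ℝ, 0 < C ∧ ∃ β₁ : ℝ, 1 ≤ β₁ ∧ ∀ (L : ℕ) [NeZero L] (b : ℝ), β₁ ≤ b → ∀ p : ℝ, 0 < p →
      ∫ q, swapRingDeficit L (fun _ => false) q ^ p * Real.exp (-b * swapRingDeficit L (fun _ => false) q) ∂(ringMeasure L) ≤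
        Real.exp 1 * (C * p * (L : ℝ) ^ 4 * (1 + Real.log L + Real.log b) / b) ^ p *
          ∫ q, Real.exp (-b * swapRingDeficit L (fun _ => false) q) ∂(ringMeasure L) := by
  obtain ⟨K, hK, β₀, hβ₀, hap⟩ := swap_meanDeficit_apriori
  refine ⟨2 * (19 + K), by positivity, 2 * β₀, by linarith, fun L _ b hb p hp => ?_⟩
  haveI := isProbabilityMeasure_ringMeasure (L := L)
  obtain ⟨M, hM⟩ := exists_abs_swapRingDeficit_le (L := L) (fun _ => false)
  have hL : (1 : ℝ) ≤ L := by exact_mod_cast NeZero.one_le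
  have hL4 : (1 : ℝ) ≤ (L : ℝ) ^ 4 := one_le_pow₀ hL
  have hlogL : 0 ≤ Real.log L := Real.log_nonneg hL
  have hb1 : 1 ≤ b := by linarith
  have hb0 : 0 < b := by linarith
  have hlogb : 0 ≤ Real.log b := Real.log_nonneg hb1
  have hA : (0 : ℝ) ≤ 2 * (9 * (L : ℝ) ^ 4 - 1) := by nlinarith
  have hB : (0 : ℝ) ≤ K * (L : ℝ) ^ 4 * (1 + Real.log L) := by positivity
  have h := integral_rpow_mul_exp_neg_le_of_apriori (ringMeasure L) (measurable_swapRingDeficit _) hM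
    (swapRingDeficit_nonneg (L := L) _) hA hB hβ₀ (fun s hs => hap L s hs) hb hp
  refine h.trans (mul_le_mul_of_nonneg_right (mul_le_mul_of_nonneg_left ?_ (by positivity))
    (integral_nonneg fun q => (Real.exp_pos _).le))
  -- `2p(A log b + B + 1)/b ≤ C p L⁴ (1 + log L + log b)/b`, then monotonicity of `x ↦ x^p`
  have hD : 2 * (9 * (L : ℝ) ^ 4 - 1) * Real.log b + K * (L : ℝ) ^ 4 * (1 + Real.log L) + 1 ≤
      (19 + K) * (L : ℝ) ^ 4 * (1 + Real.log L + Real.log b) := by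
    nlinarith [mul_nonneg (sub_nonneg.2 hL4) hlogb, mul_nonneg hK (mul_nonneg (zero_le_one.trans hL4) hlogb),
      mul_nonneg (zero_le_one.trans hL4) hlogL, mul_nonneg (zero_le_one.trans hL4) hlogb]
  have hnum : 0 ≤ 2 * p * (2 * (9 * (L : ℝ) ^ 4 - 1) * Real.log b + K * (L : ℝ) ^ 4 * (1 + Real.log L) + 1) / b := by positivity
  refine Real.rpow_le_rpow hnum ?_ hp.le
  rw [div_le_div_iff_of_pos_right hb0]
  have : 2 * p * ((19 + K) * (L : ℝ) ^ 4 * (1 + Real.log L + Real.log b)) =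
      2 * (19 + K) * p * (L : ℝ) ^ 4 * (1 + Real.log L + Real.log b) := by ring
  rw [← this]
  exact mul_le_mul_of_nonneg_left hD (by positivity)


/-- ★★ **WINDOW-UNIFORM SECOND MOMENT** (`p = 2`): ABSOLUTE `C > 0`, `β₁ ≥ 1` with, for EVERY `L ≥ 1` and `b ≥ β₁`,
`∫ F₀² e^{−bF₀} dμ_L ≤ C·L⁸·(1 + log L + log b)²/b² · ∫ e^{−bF₀} dμ_L` — in particular `Var_b(F₀) ≤ ⟨F₀²⟩_b ≤ C L⁸ (1 + log L + log b)²/b²`: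
the reverse-Hölder ∕ concentration input `⟨F₀²⟩_b ≲ ⟨F₀⟩_b²` (up to `log`s) uniformly in `L`. [cite: Griffiths1964] [cite: tHooft1979] -/
theorem swap_deficit_sq_moment_le :
    ∃ C : ℝ, 0 < C ∧ ∃ β₁ : ℝ, 1 ≤ β₁ ∧ ∀ (L : ℕ) [NeZero L] (b : ℝ), β₁ ≤ b →
      ∫ q, swapRingDeficit L (fun _ => false) q ^ 2 * Real.exp (-b * swapRingDeficit L (fun _ => false) q) ∂(ringMeasure L) ≤
        C * (L : ℝ) ^ 8 * (1 + Real.log L + Real.log b) ^ 2 / b ^ 2 *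
          ∫ q, Real.exp (-b * swapRingDeficit L (fun _ => false) q) ∂(ringMeasure L) := by
  obtain ⟨C, hC, β₁, hβ₁, h⟩ := swap_deficit_rpow_moment_le
  refine ⟨Real.exp 1 * (2 * C) ^ 2, by positivity, β₁, hβ₁, fun L _ b hb => ?_⟩
  have h2 := h L b hb 2 (by norm_num)
  have hb0 : 0 < b := by linarith
  have e1 : ∀ q, swapRingDeficit L (fun _ => false) q ^ (2 : ℝ) = swapRingDeficit L (fun _ => false) q ^ 2 := fun q => Real.rpow_two _
  simp only [e1] at h2
  refine h2.trans (le_of_eq ?_)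
  rw [Real.rpow_two]
  ring

/-- ★★ **THE FOLLOWERS' CUBIC REMAINDER IS FREE** (`p = 3/2`): ABSOLUTE `C > 0`, `β₁ ≥ 1` with, for EVERY `L ≥ 1` and `b ≥ β₁`,
`b · ∫ F₀^{3/2} e^{−bF₀} dμ_L ≤ C · (L⁴·(1 + log L + log b))^{3/2} · b^{−1/2} · ∫ e^{−bF₀} dμ_L`,
i.e. `β·⟨F₀^{3/2}⟩_β = O(L⁶ (log β)^{3/2} β^{−1/2})` uniformly in `L` — so a pointwise Taylor bound `|R_F| ≤ poly(L)·F̂^{3/2}` makes the followers'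
share of the virial remainder `β·K_L⟪R⟫₀` negligible against `Z₀` on every window `L ≤ β^a` with `a` small (the concentration input asked for in
fcl-p3 g46's memo2 §3; Jensen alone cannot give it). [cite: Griffiths1964] [cite: Luscher1983, §2] -/
theorem swap_deficit_threeHalves_moment_le :
    ∃ C : ℝ, 0 < C ∧ ∃ β₁ : ℝ, 1 ≤ β₁ ∧ ∀ (L : ℕ) [NeZero L] (b : ℝ), β₁ ≤ b →
      b * ∫ q, swapRingDeficit L (fun _ => false) q ^ ((3 : ℝ) / 2) * Real.exp (-b * swapRingDeficit L (fun _ => false) q) ∂(ringMeasure L) ≤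
        C * ((L : ℝ) ^ 4 * (1 + Real.log L + Real.log b)) ^ ((3 : ℝ) / 2) * b ^ (-(1 : ℝ) / 2) *
          ∫ q, Real.exp (-b * swapRingDeficit L (fun _ => false) q) ∂(ringMeasure L) := by
  obtain ⟨C, hC, β₁, hβ₁, h⟩ := swap_deficit_rpow_moment_le
  refine ⟨Real.exp 1 * ((3 : ℝ) / 2 * C) ^ ((3 : ℝ) / 2), by positivity, β₁, hβ₁, fun L _ b hb => ?_⟩
  have h32 := h L b hb ((3 : ℝ) / 2) (by norm_num)
  have hb0 : 0 < b := by linarith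
  have hL : (0 : ℝ) ≤ L := Nat.cast_nonneg _
  have hL1 : (1 : ℝ) ≤ L := by exact_mod_cast NeZero.one_le
  have hℓ : 0 ≤ 1 + Real.log L + Real.log b := by
    have := Real.log_nonneg hL1; have := Real.log_nonneg (hβ₁.trans hb); linarith
  set X : ℝ := (L : ℝ) ^ 4 * (1 + Real.log L + Real.log b) with hX
  have hX0 : 0 ≤ X := by positivity
  set Z : ℝ := ∫ q, Real.exp (-b * swapRingDeficit L (fun _ => false) q) ∂(ringMeasure L) with hZ
  have hZ0 : 0 ≤ Z := integral_nonneg fun q => (Real.exp_pos _).le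
  -- `b · (c·X/b)^{3/2} = c^{3/2} · X^{3/2} · b^{−1/2}`
  have e1 : C * ((3 : ℝ) / 2) * (L : ℝ) ^ 4 * (1 + Real.log L + Real.log b) / b = ((3 : ℝ) / 2 * C) * X / b := by rw [hX]; ring
  rw [e1] at h32
  have e2 : b * (((3 : ℝ) / 2 * C) * X / b) ^ ((3 : ℝ) / 2) = ((3 : ℝ) / 2 * C) ^ ((3 : ℝ) / 2) * X ^ ((3 : ℝ) / 2) * b ^ (-(1 : ℝ) / 2) := by
    rw [Real.div_rpow (by positivity) hb0.le, Real.mul_rpow (by positivity) hX0]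
    have hb32 : b ^ ((3 : ℝ) / 2) = b * b ^ ((1 : ℝ) / 2) := by
      rw [show ((3 : ℝ) / 2) = 1 + 1 / 2 by norm_num, Real.rpow_add hb0, Real.rpow_one]
    have hbneg : b ^ (-(1 : ℝ) / 2) = (b ^ ((1 : ℝ) / 2))⁻¹ := by
      rw [show (-(1 : ℝ) / 2) = -((1 : ℝ) / 2) by norm_num, Real.rpow_neg hb0.le]
    rw [hb32, hbneg]
    have hb12 : 0 < b ^ ((1 : ℝ) / 2) := Real.rpow_pos_of_pos hb0 _
    field_simp
  calc b * ∫ q, swapRingDeficit L (fun _ => false) q ^ ((3 : ℝ) / 2) * Real.exp (-b * swapRingDeficit L (fun _ => false) q) ∂(ringMeasure L)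
      ≤ b * (Real.exp 1 * (((3 : ℝ) / 2 * C) * X / b) ^ ((3 : ℝ) / 2) * Z) := mul_le_mul_of_nonneg_left h32 hb0.le
    _ = Real.exp 1 * ((3 : ℝ) / 2 * C) ^ ((3 : ℝ) / 2) * X ^ ((3 : ℝ) / 2) * b ^ (-(1 : ℝ) / 2) * Z := by
        rw [show b * (Real.exp 1 * (((3 : ℝ) / 2 * C) * X / b) ^ ((3 : ℝ) / 2) * Z) =
          Real.exp 1 * (b * (((3 : ℝ) / 2 * C) * X / b) ^ ((3 : ℝ) / 2)) * Z by ring, e2]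
        ring

/-- ★ **CHEBYSHEV TAIL OF THE GIBBS LAW**: ABSOLUTE `C > 0`, `β₁ ≥ 1` with, for EVERY `L ≥ 1`, `b ≥ β₁`, threshold `s > 0` and `p > 0`,
`∫ 𝟙{s ≤ F₀}·e^{−bF₀} dμ_L ≤ e·(C·p·L⁴·(1 + log L + log b)/(b·s))^p · ∫ e^{−bF₀} dμ_L`: the Gibbs probability of `{F₀ ≥ s}` decays faster than
any power of `L⁴ log b/(b s)` — a log-free-in-`L⁴` companion of ✓`largeField_share_le` near the threshold `b·s ≍ L⁴ log b`. [folklore] [cite: tHooft1979] -/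
theorem swap_deficit_gibbs_tail_le :
    ∃ C : ℝ, 0 < C ∧ ∃ β₁ : ℝ, 1 ≤ β₁ ∧ ∀ (L : ℕ) [NeZero L] (b : ℝ), β₁ ≤ b → ∀ s : ℝ, 0 < s → ∀ p : ℝ, 0 < p →
      ∫ q, Set.indicator {q | s ≤ swapRingDeficit L (fun _ => false) q}
          (fun q => Real.exp (-b * swapRingDeficit L (fun _ => false) q)) q ∂(ringMeasure L) ≤
        Real.exp 1 * (C * p * (L : ℝ) ^ 4 * (1 + Real.log L + Real.log b) / (b * s)) ^ p *
          ∫ q, Real.exp (-b * swapRingDeficit L (fun _ => false) q) ∂(ringMeasure L) := by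
  obtain ⟨C, hC, β₁, hβ₁, h⟩ := swap_deficit_rpow_moment_le
  refine ⟨C, hC, β₁, hβ₁, fun L _ b hb s hs p hp => ?_⟩
  haveI := isProbabilityMeasure_ringMeasure (L := L)
  have hp' := h L b hb p hp
  have hb0 : 0 < b := by linarith
  set F : ((Fin (2 * L - 1 + 1) → GaugeConfig 3 L SU2) × (Site 3 L → SU2)) → ℝ := swapRingDeficit L (fun _ => false) with hFdef
  have hF0 : ∀ q, 0 ≤ F q := swapRingDeficit_nonneg (L := L) _
  obtain ⟨M, hM⟩ := exists_abs_swapRingDeficit_le (L := L) (fun _ => false)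
  -- integrability of `F^p e^{−bF}` (bounded measurable on a probability space)
  have hFm : Measurable F := measurable_swapRingDeficit _
  have hint : Integrable (fun q => F q ^ p * Real.exp (-b * F q)) (ringMeasure L) := by
    refine Integrable.mono' (integrable_const (M ^ p * Real.exp (b * M)))
      ((hFm.pow_const p).mul (Real.measurable_exp.comp (hFm.const_mul (-b)))).aestronglyMeasurable (ae_of_all _ fun q => ?_)
    have hFq : F q ≤ M := (le_abs_self _).trans (hM q)
    have hM0 : 0 ≤ M := (hF0 q).trans hFq
    rw [Real.norm_eq_abs, abs_of_nonneg (mul_nonneg (Real.rpow_nonneg (hF0 q) _) (Real.exp_pos _).le)]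
    refine mul_le_mul (Real.rpow_le_rpow (hF0 q) hFq hp.le) (Real.exp_le_exp.2 ?_) (Real.exp_pos _).le (by positivity)
    nlinarith [hF0 q, abs_nonneg (F q), hM q]
  -- pointwise: `𝟙{s ≤ F} e^{−bF} ≤ (F/s)^p e^{−bF} = s^{−p}·F^p e^{−bF}`
  have hpt : ∀ q, Set.indicator {q | s ≤ F q} (fun q => Real.exp (-b * F q)) q ≤ s ^ (-p) * (F q ^ p * Real.exp (-b * F q)) := by
    intro q
    by_cases hq : q ∈ {q | s ≤ F q}
    · rw [Set.indicator_of_mem hq]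
      have hsF : s ≤ F q := hq
      have h1 : 1 ≤ s ^ (-p) * F q ^ p := by
        rw [Real.rpow_neg hs.le, ← div_eq_inv_mul, ← Real.div_rpow (hF0 q) hs.le]
        exact Real.one_le_rpow ((one_le_div hs).2 hsF) hp.le
      calc Real.exp (-b * F q) = 1 * Real.exp (-b * F q) := (one_mul _).symm
        _ ≤ (s ^ (-p) * F q ^ p) * Real.exp (-b * F q) := mul_le_mul_of_nonneg_right h1 (Real.exp_pos _).le
        _ = _ := by ring
    · rw [Set.indicator_of_notMem hq]
      exact mul_nonneg (Real.rpow_nonneg hs.le _) (mul_nonneg (Real.rpow_nonneg (hF0 q) _) (Real.exp_pos _).le)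
  have hZ0 : 0 ≤ ∫ q, Real.exp (-b * F q) ∂(ringMeasure L) := integral_nonneg fun q => (Real.exp_pos _).le
  calc ∫ q, Set.indicator {q | s ≤ F q} (fun q => Real.exp (-b * F q)) q ∂(ringMeasure L)
      ≤ ∫ q, s ^ (-p) * (F q ^ p * Real.exp (-b * F q)) ∂(ringMeasure L) :=
        integral_mono_of_nonneg (ae_of_all _ fun q => Set.indicator_nonneg (fun _ _ => (Real.exp_pos _).le) _)
          (hint.const_mul _) (ae_of_all _ hpt)
    _ = s ^ (-p) * ∫ q, F q ^ p * Real.exp (-b * F q) ∂(ringMeasure L) := integral_const_mul _ _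
    _ ≤ s ^ (-p) * (Real.exp 1 * (C * p * (L : ℝ) ^ 4 * (1 + Real.log L + Real.log b) / b) ^ p *
          ∫ q, Real.exp (-b * F q) ∂(ringMeasure L)) := mul_le_mul_of_nonneg_left hp' (Real.rpow_nonneg hs.le _)
    _ = Real.exp 1 * (C * p * (L : ℝ) ^ 4 * (1 + Real.log L + Real.log b) / (b * s)) ^ p *
          ∫ q, Real.exp (-b * F q) ∂(ringMeasure L) := by
        have e : (C * p * (L : ℝ) ^ 4 * (1 + Real.log L + Real.log b) / (b * s)) ^ p =
            s ^ (-p) * (C * p * (L : ℝ) ^ 4 * (1 + Real.log L + Real.log b) / b) ^ p := by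
          rw [show C * p * (L : ℝ) ^ 4 * (1 + Real.log L + Real.log b) / (b * s) =
            (C * p * (L : ℝ) ^ 4 * (1 + Real.log L + Real.log b) / b) / s by rw [div_div],
            Real.div_rpow ?_ hs.le, Real.rpow_neg hs.le, div_eq_inv_mul]
          have hL1 : (1 : ℝ) ≤ L := by exact_mod_cast NeZero.one_le
          have := Real.log_nonneg hL1; have := Real.log_nonneg (hβ₁.trans hb)
          positivity
        rw [e]; ring

end Summit.QuantumFields.YangMills.Theorems.SwapVirialDeficit.SwapRing

end
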